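import Literature.Computability.AlgebraicComplexity.BDI20HwvEvaluationHardness
import HarnessLib

/-!
# Bläser–Dörfler–Ikenmeyer 2020/2021, Prop 7.5 (1): treewidth of two-row tableau graphs —
# the definitions of a direct path decomposition

Cell `val-lit`, seat x6 (gen 5). This small DEFINITIONS file carries the plumbing of the proof of
the typed fact `BDI2020_prop_7_5_upper` (`BDI20HwvEvaluationHardness.lean`: "Let `S_n` be a
semistandard Young tableau with two rows containing the numbers `{1, …, n}`. Then `G_{S_n}` has
treewidth at most `O(√n)`", CCC 2021 Prop 7.5 (1) = arXiv Prop 20 (1)); every theorem — in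
particular `BDI2020_prop_7_5_upper_holds` — is in the theorem-only sibling
`BDI20TableauTreewidthProofs.lean`. No named fact (`def … : Prop` without arguments) is
introduced; the `Prop`-valued definitions below are predicates of the construction.

HONEST FRAMING / DEVIATION FROM PRINT. The printed proof is one line: `G_S` is planar (Prop 7.4 =
arXiv Prop 19) and "planar graphs on `n` vertices have treewidth bounded by `O(√n)` … [by] the
planar excluded grid theorem [RobertsonSeymourThomas94]". Neither planarity nor the planar
separator / excluded-grid theorem is in the tree, so that road is not followed. Instead we use
the observation inside the proof of Prop 7.4 (arXiv p0016.txt:L7-8: for two columns `(i,j)`,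
`(k,l)` with the first to the left, "`T` being semistandard … implies `i ≤ k` and `j ≤ l`, which
means those two edges do not cross"): the EDGE SET of `G_S`, read as pairs (smaller end, larger
end), is a CHAIN in `ℕ²` for the product order (`IsChainRel`). For such "chain graphs" on
`{0, …, n-1}` we build an explicit PATH decomposition of width `< 12 (⌊√n⌋ + 1)`:

* ROWS (`xr`, `row`): `x₀ = 0`, `x_{i+1}` = the least head of an edge with tail `≥ x_i`; row `i`
  is `[x_i, x_{i+1})`. Every edge goes from a row `i` to row `i+1`, or to the first vertex
  `x_{i+2}` of row `i+2` ("exceptional" edges).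
* UNITS (`Wide`, `IsEnd`, `unitOf`): a row is wide when it has more than `s = ⌊√n⌋ + 1` vertices
  (there are fewer than `s` wide rows); a unit is a maximal run of rows ending at the first narrow
  row that follows a narrow row; a unit has at most `2·#wide + 1 < 2s` rows.
* THE PROCESS (`par`, `Ready`, `nextV`, `readyRows`, `prio`, `sel`, `step`, `Pk`, `key`): vertices
  are processed one at a time; a row may advance (process its least unprocessed vertex `v`) when
  `v` is ready — its parent `par v` (least tail in the previous row, else the predecessor `v-1`)
  is processed; among ready rows the one in the earliest unit, and inside a unit the DEEPEST, goes
  first. This is the greedy "one bag at a time" sweep by which a leveled planar drawing yields a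
  layered path decomposition of layered width one [BannisterEtAl2015, Lemma 3 and Thm 2],
  adapted to the exceptional edges and run unit by unit; between units the order is the natural
  order of the labels. `key v` = the time at which `v` is processed.
* BAGS (`keyBag`): for ANY key `V → ℕ` the sets `{key = t} ∪ {u : key u < t, u has a neighbour of
  key ≥ t}` form a path decomposition (vertex-separation style); `Inv` is the invariant of the
  process and `incomplete`, `PR`, `D1`, `D2`, `U1`, `U2` are the pieces of the cover of a bag used
  to count it (at most four "internal" incomplete vertices per row of the current unit, plus four
  narrow boundary rows).

## References
* [BlaserDorflerIkenmeyer2020] M. Bläser, J. Dörfler, C. Ikenmeyer, *On the complexity of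
  evaluating highest weight vectors*, arXiv:2002.11594, Props 19, 20 (= CCC 2021, LIPIcs 200:29,
  Props 7.4, 7.5); held text `paper:arxiv-2002.11594` p0015.txt:L91 – p0016.txt:L30.
* [BannisterEtAl2015] M. J. Bannister, W. E. Devanny, V. Dujmović, D. Eppstein, D. R. Wood,
  *Track layouts, layered path decompositions, and leveled planarity*, Algorithmica 81 (2019)
  1561–1583, arXiv:1506.09145, §3.2 Lemma 3, Thm 2 (held text `paper:arxiv-1506.09145`
  p0006.txt:L9-29): the greedy layered path decomposition of a leveled planar graph.
* Tree vocabulary: `Literature.Combinatorics.SimpleGraph.treewidth`, `TreeDecomposition.ofIntervals`,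
  `treewidth_le_of_intervals` (`Combinatorics/SimpleGraph/TreeDecomposition.lean`);
  `BDI2020.tableauGraph`, `BDI2020.IsSemistandard`, `BDI2020_prop_7_5_upper`
  (`BDI20HwvEvaluationHardness.lean`).
-/

noncomputable section

open scoped Classical

namespace Literature.Computability.AlgebraicComplexity

namespace BDI20Treewidth

/-! ### Path decompositions from an arbitrary key function -/

/-- The bag at threshold `t` of the path decomposition induced by a key `key : V → ℕ`: the
vertices of key exactly `t` together with the vertices of smaller key having a neighbour of key
`≥ t` (the vertex-separation bags of the linear layout `key`, allowing ties). [folklore] -/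
def keyBag {V : Type*} [Fintype V] (G : _root_.SimpleGraph V) (key : V → ℕ) (t : ℕ) : Finset V :=
  Finset.univ.filter fun v => key v = t ∨ (key v < t ∧ ∃ u, G.Adj v u ∧ t ≤ key u)

/-! ### Chain relations on `ℕ` -/

/-- An edge relation `E a b` ("`a` is a tail of the head `b`") on `{0, …, n-1}` whose edges form
a chain in `ℕ²`: tails before heads, heads `< n`, and of two edges the one with the larger tail
has the larger-or-equal head — the "two edges do not cross" property of the columns of a
two-row semistandard tableau observed in the proof of BDI Prop 7.4.
[cite: BlaserDorflerIkenmeyer2020, Prop 19 (proof; arXiv p0016.txt:L7-8; = CCC 2021 Prop 7.4)] -/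
structure IsChainRel (n : ℕ) (E : ℕ → ℕ → Prop) : Prop where
  lt : ∀ {a b : ℕ}, E a b → a < b
  bound : ∀ {a b : ℕ}, E a b → b < n
  chain : ∀ {a b a' b' : ℕ}, E a b → E a' b' → a < a' → b ≤ b'

section Defs

variable (n : ℕ) (E : ℕ → ℕ → Prop)

/-! ### Rows -/

/-- Row starts: `xr 0 = 0`, and `xr (i+1)` is the least head of an edge whose tail is `≥ xr i`
(`n` if there is none). [folklore] -/
def xr (i : ℕ) : ℕ :=
  Nat.rec (motive := fun _ => ℕ) 0
    (fun _ x => if h : ∃ b a, x ≤ a ∧ E a b then Nat.find h else n) i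

/-- The row of a vertex `v < n`: the `i` with `xr i ≤ v < xr (i+1)` (junk `0` otherwise).
[folklore] -/
def row (v : ℕ) : ℕ :=
  if h : ∃ i, v < xr n E (i + 1) then Nat.find h else 0

/-- The vertices of row `i`, the interval `[xr i, xr (i+1))`. [folklore] -/
def rowSet (i : ℕ) : Finset ℕ := Finset.Ico (xr n E i) (xr n E (i + 1))

/-- The tails of `v` lying in the row just above the row of `v`. [folklore] -/
def prevTails (v : ℕ) : Finset ℕ :=
  (Finset.range n).filter fun a => E a v ∧ row n E a + 1 = row n E v

/-- The parent of `v`: its least tail in the previous row if it has one, else its predecessor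
`v - 1` (so `par 0 = 0`). [folklore] -/
def par (v : ℕ) : ℕ :=
  if h : (prevTails n E v).Nonempty then (prevTails n E v).min' h else v - 1

/-! ### Units -/

/-- The width threshold `s = ⌊√n⌋ + 1` (so `n < s²`). [folklore] -/
def sPar : ℕ := Nat.sqrt n + 1

/-- A row is wide when it has more than `s` vertices.
[cite: BlaserDorflerIkenmeyer2020, Prop 20 (1) (arXiv; = CCC 2021 Prop 7.5 (1)) — construction of OUR proof, not the printed argument] -/
def Wide (i : ℕ) : Prop := sPar n < xr n E (i + 1) - xr n E i

/-- Row `i` ends a unit when it is narrow and the row before it (if any) is narrow.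
[cite: BlaserDorflerIkenmeyer2020, Prop 20 (1) (arXiv; = CCC 2021 Prop 7.5 (1)) — construction of OUR proof, not the printed argument] -/
def IsEnd (i : ℕ) : Prop := ¬ Wide n E i ∧ (i = 0 ∨ ¬ Wide n E (i - 1))

/-- The unit of a row: the number of unit ends strictly before it. [folklore] -/
def unitOf (i : ℕ) : ℕ := ((Finset.range i).filter fun i' => IsEnd n E i').card

/-- Processing priority of a row (smaller goes first): earlier units first, and inside a unit the
deeper rows first. [folklore] -/
def prio (i : ℕ) : ℕ := unitOf n E i * (n + 1) + (n - i)

/-! ### The process -/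

/-- The vertices of row `i` not yet processed (not in `P`). [folklore] -/
def missing (P : Finset ℕ) (i : ℕ) : Finset ℕ := rowSet n E i \ P

/-- The least unprocessed vertex of row `i` (junk `0` if the row is fully processed). [folklore] -/
def nextV (P : Finset ℕ) (i : ℕ) : ℕ :=
  if h : (missing n E P i).Nonempty then (missing n E P i).min' h else 0

/-- A vertex is ready when its parent has been processed; the root `0` is always ready. This is
the advancing condition of the greedy layered sweep ("a vertex whose neighbors all belong to the
present bag or earlier bags"), weakened to the leftmost upper neighbour.
[cite: BannisterEtAl2015, Lemma 3 and Thm 2 (proof), arXiv p0006.txt:L11-29 (adapted)] -/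
def Ready (P : Finset ℕ) (v : ℕ) : Prop := v = 0 ∨ par n E v ∈ P

/-- The rows (indices `≤ n`) whose least unprocessed vertex exists and is ready. [folklore] -/
def readyRows (P : Finset ℕ) : Finset ℕ :=
  (Finset.range (n + 1)).filter fun i => (missing n E P i).Nonempty ∧ Ready n E P (nextV n E P i)

/-- The selected row: a ready row of least priority value. [folklore] -/
def sel (P : Finset ℕ) (h : (readyRows n E P).Nonempty) : ℕ :=
  Classical.choose (Finset.exists_min_image (readyRows n E P) (prio n E) h)

/-- One step of the process: process the least unprocessed vertex of the selected row (no change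
when no row is ready). [cite: BannisterEtAl2015, Thm 2 (proof: "forming the next bag by replacing
v with the next vertex to the right of v in the same level"), arXiv p0006.txt:L28 (adapted)] -/
def step (P : Finset ℕ) : Finset ℕ :=
  if h : (readyRows n E P).Nonempty then insert (nextV n E P (sel n E P h)) P else P

/-- The processed set after `k` steps. [folklore] -/
def Pk (k : ℕ) : Finset ℕ :=
  Nat.rec (motive := fun _ => Finset ℕ) ∅ (fun _ P => step n E P) k

/-- The key of a vertex: the number of steps after which it is processed (junk `0` if never).
[folklore] -/
def key (v : ℕ) : ℕ :=
  if h : ∃ k, v ∈ Pk n E (k + 1) then Nat.find h else 0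

/-- The invariant maintained by the process: processed vertices are `< n`; each row is processed
as an initial segment (`prefix_`); processed vertices are ready (`closed`); units are processed
one after the other (`seq`); a processed vertex of row `i` with an unprocessed head in row `i+1`
of the same unit is the least previous-row tail of a vertex at or left of the least unprocessed
vertex of row `i+1` (`j1`); and once two processed vertices of a row are tails of the exceptional
head `xr (i+2)` (same unit), that head is processed (`j2`).
[cite: BlaserDorflerIkenmeyer2020, Prop 20 (1) (arXiv; = CCC 2021 Prop 7.5 (1)) — construction of OUR proof, not the printed argument] -/
structure Inv (P : Finset ℕ) : Prop where
  sub : ∀ ⦃v : ℕ⦄, v ∈ P → v < n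
  prefix_ : ∀ ⦃u v : ℕ⦄, v ∈ P → u < v → row n E u = row n E v → u ∈ P
  closed : ∀ ⦃v : ℕ⦄, v ∈ P → Ready n E P v
  seq : ∀ ⦃u v : ℕ⦄, u ∈ P → v < n → unitOf n E (row n E v) < unitOf n E (row n E u) → v ∈ P
  j1 : ∀ ⦃u b : ℕ⦄, u ∈ P → E u b → b ∉ P → row n E b = row n E u + 1 →
      unitOf n E (row n E u + 1) = unitOf n E (row n E u) →
      ∃ v', row n E v' = row n E u + 1 ∧ v' ≤ nextV n E P (row n E u + 1) ∧
        u ∈ prevTails n E v' ∧ ∀ a ∈ prevTails n E v', u ≤ a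
  j2 : ∀ ⦃a a' : ℕ⦄, a ∈ P → a' ∈ P → a < a' → row n E a' = row n E a →
      E a (xr n E (row n E a + 2)) → E a' (xr n E (row n E a + 2)) →
      unitOf n E (row n E a + 2) = unitOf n E (row n E a) → xr n E (row n E a + 2) ∈ P

/-! ### Pieces of the bag cover -/

/-- Processed vertices with an unprocessed neighbour (`< n`). [folklore] -/
def incomplete (P : Finset ℕ) : Finset ℕ :=
  P.filter fun u => ∃ w, w < n ∧ w ∉ P ∧ (E u w ∨ E w u)

/-- Processed vertices of row `i`. [folklore] -/
def PR (P : Finset ℕ) (i : ℕ) : Finset ℕ := P.filter fun u => row n E u = i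

/-- Row-`i` processed vertices with an unprocessed head in row `i+1`. [folklore] -/
def D1 (P : Finset ℕ) (i : ℕ) : Finset ℕ :=
  P.filter fun u => row n E u = i ∧ ∃ b, E u b ∧ row n E b = i + 1 ∧ b ∉ P

/-- Row-`i` processed vertices that are tails of the unprocessed exceptional head `xr (i+2)`.
[folklore] -/
def D2 (P : Finset ℕ) (i : ℕ) : Finset ℕ :=
  P.filter fun u => row n E u = i ∧ E u (xr n E (i + 2)) ∧ xr n E (i + 2) ∉ P

/-- Row-`i` processed vertices with an unprocessed tail in row `i-1`. [folklore] -/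
def U1 (P : Finset ℕ) (i : ℕ) : Finset ℕ :=
  P.filter fun u => row n E u = i ∧ ∃ a, E a u ∧ row n E a + 1 = i ∧ a ∉ P

/-- Row-`i` processed vertices with an unprocessed tail in row `i-2`. [folklore] -/
def U2 (P : Finset ℕ) (i : ℕ) : Finset ℕ :=
  P.filter fun u => row n E u = i ∧ ∃ a, E a u ∧ row n E a + 2 = i ∧ a ∉ P

end Defs

/-- The tail/head relation of a graph on `Fin n`, as a relation on `ℕ`: `relOf G a b` iff
`a < b < n` and `{a, b}` is an edge (edges read as ordered pairs, as the columns `(i, j)`, `i < j`,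
of a two-row tableau in the proof of BDI Prop 7.4).
[cite: BlaserDorflerIkenmeyer2020, Prop 19 (proof; arXiv p0016.txt:L4-8; = CCC 2021 Prop 7.4)] -/
def relOf {n : ℕ} (G : _root_.SimpleGraph (Fin n)) (a b : ℕ) : Prop :=
  ∃ h : a < b ∧ b < n, G.Adj ⟨a, lt_trans h.1 h.2⟩ ⟨b, h.2⟩

end BDI20Treewidth

end Literature.Computability.AlgebraicComplexity

end
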